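import Mathlib
import Summits.ValiantsHypothesis.ValiantsHypothesis.Theorems.PermanentalConesPermanentalConeHardGardingGradient
import Literature.AlgebraicGeometry.HyperbolicPolynomials.HyperbolicityCone
import Literature.AlgebraicGeometry.HyperbolicPolynomials.Garding
import Literature.AlgebraicGeometry.HyperbolicPolynomials.SmoothBoundary

/-!
# `PermanentalConeHard` (stmt-ValiantsHypothesis-8654), line `birth` — the cone is cut out by its gradients

Route `PermanentalCones` of `ValiantsHypothesis`, crux `PermanentalConeHard` (H+), core stub
`stub_permanentalGradientPsdRank` (psd-rank of the GRADIENT SLACK MATRICES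
`S[x,z] = gradForm Q_n z x = ⟨∇Q_n(z), x⟩`, `x, z ∈ Λ₊(Q_n, 𝟙)`).  The converse of the registered
skeleton (H+ ⇒ CORE, file `…CoreIffCrux.lean`) needs the fact that the gradient functionals
`∇Q(z)`, `z ∈ Λ₊`, generate the dual cone, i.e. CUT OUT the cone.  This file proves it for every
form `f` hyperbolic w.r.t. `e` with `f(e) > 0`:

* `gradForm_self_eq` — Euler: `⟨∇f(z), z⟩ = d · f(z)` for a form of degree `d`.
* `gradForm_dir_eq` — `⟨∇f(x + s e), e⟩ = f(e) · (∏ᵢ (s + λᵢ(x))) · Σᵢ (s + λᵢ(x))⁻¹`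
  (eigenvalues `λᵢ(x)` of `x` in direction `e`, all `s + λᵢ(x) ≠ 0`).
* `exists_gradForm_neg_of_not_mem` — if `x ∉ Λ₊(f, e)` then `⟨∇f(z), x⟩ < 0` at the INTERIOR
  point `z = x + s e`, `s = |λ_min(x)| (1 + 1/(2d))`:
  `⟨∇f(z), x⟩ = ⟨∇f(z), z⟩ - s⟨∇f(z), e⟩ = f(z)(d - Σᵢ s/(s + λᵢ(x))) ≤ f(z)(d - (2d+1)) < 0`.
* `hyperbolicityCone_eq_setOf_forall_gradForm_nonneg` — with Gårding's lemma
  (`stub_gardingGradient`): `Λ₊(f, e) = {x : ⟨∇f(z), x⟩ ≥ 0 ∀ z ∈ Λ₊(f, e)}`.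

References: Renegar, *Hyperbolic programs and their derivative relaxations*, Found. Comput.
Math. 6 (2006) §2 (`p(x + te) = p(e)∏(t + λᵢ(x))`); Gårding 1959, Thm 2 (dual cone).  Proved in
full.
-/

set_option linter.dupNamespace false

noncomputable section

namespace Summit.ValiantsHypothesis.ValiantsHypothesis.Theorems.PermanentalConesPermanentalConeHard

open MvPolynomial Finset
open scoped BigOperators Polynomial Matrix
open Literature.AlgebraicGeometry.HyperbolicPolynomials

/-! ## §1  Gradients at interior points cut out the cone -/

section DualGeneration

variable {σ : Type*} [Fintype σ] {f : MvPolynomial σ ℝ} {d : ℕ} {e : σ → ℝ}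

/-- **Euler's identity in gradient form**: `⟨∇f(z), z⟩ = d · f(z)` for a form of degree `d`.
[folklore] -/
theorem gradForm_self_eq (hf : f.IsHomogeneous d) (z : σ → ℝ) :
    gradForm f z z = (d : ℝ) * MvPolynomial.eval z f := by
  classical
  have h := congrArg (MvPolynomial.eval z) hf.sum_X_mul_pderiv
  simp only [map_sum, map_mul, MvPolynomial.eval_X, nsmul_eq_mul, map_natCast] at h
  change (∑ j, z j * MvPolynomial.eval z (pderiv j f)) = _
  rw [h]

/-- For nonzero reals `aᵢ`, `∏ᵢ (X + aᵢ) = (∏ᵢ aᵢ) · ∏ᵢ (1 + aᵢ⁻¹ X)`. [folklore] -/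
theorem prod_X_add_C_eq_C_mul_prodOneAdd (μ : Multiset ℝ) (hμ : ∀ a ∈ μ, a ≠ 0) :
    (μ.map fun a => Polynomial.X + Polynomial.C a).prod =
      Polynomial.C μ.prod * prodOneAdd (μ.map fun a => a⁻¹) := by
  induction μ using Multiset.induction_on with
  | empty => simp [prodOneAdd]
  | cons a μ ih =>
      have ha : a ≠ 0 := hμ a (Multiset.mem_cons_self a μ)
      have hμ' : ∀ b ∈ μ, b ≠ 0 := fun b hb => hμ b (Multiset.mem_cons_of_mem hb)
      rw [Multiset.map_cons, Multiset.prod_cons, ih hμ', Multiset.map_cons, prodOneAdd_cons,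
        Multiset.prod_cons]
      have hXa : (Polynomial.X + Polynomial.C a : ℝ[X]) =
          Polynomial.C a * (1 + Polynomial.C a⁻¹ * Polynomial.X) := by
        rw [mul_add, mul_one, ← mul_assoc, ← Polynomial.C_mul, mul_inv_cancel₀ ha,
          Polynomial.C_1, one_mul, add_comm]
      rw [hXa, Polynomial.C_mul]
      ring

/-- **The gradient in the hyperbolicity direction along the line `x + s e`**: if all
`s + λᵢ(x) ≠ 0` then `⟨∇f(x + se), e⟩ = f(e) · (∏ᵢ (s + λᵢ(x))) · Σᵢ (s + λᵢ(x))⁻¹`.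
[cite: Renegar2006, §2] -/
theorem gradForm_dir_eq (hf : f.IsHomogeneous d) (he : IsHyperbolic f e) (x : σ → ℝ) {s : ℝ}
    (hs : ∀ lam ∈ eigenvalues f e x, s + lam ≠ 0) :
    gradForm f (x + s • e) e = MvPolynomial.eval e f *
      (((eigenvalues f e x).map fun lam => s + lam).prod *
        ((eigenvalues f e x).map fun lam => (s + lam)⁻¹).sum) := by
  -- the line polynomial `t ↦ f(x + se + te) = f(e) ∏ (t + (s + λᵢ))`
  have hline : linePoly f (x + s • e) e = Polynomial.C (MvPolynomial.eval e f) *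
      ((eigenvalues f e x).map fun lam => Polynomial.X + Polynomial.C (s + lam)).prod := by
    refine Polynomial.funext fun t => ?_
    rw [eval_linePoly, Polynomial.eval_mul, Polynomial.eval_C, Polynomial.eval_multiset_prod,
      Multiset.map_map]
    have hxt : x + s • e + t • e = x + (s + t) • e := by rw [add_smul, add_assoc]
    rw [hxt, eval_add_smul_eq_eval_mul_prod_eigenvalues hf he x (s + t)]
    congr 1
    refine congrArg Multiset.prod (Multiset.map_congr rfl fun lam _ => ?_)
    simp only [Function.comp_apply, Polynomial.eval_add, Polynomial.eval_X, Polynomial.eval_C]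
    ring
  have hne : ∀ a ∈ (eigenvalues f e x).map (fun lam => s + lam), a ≠ 0 := by
    intro a ha
    obtain ⟨lam, hlam, rfl⟩ := Multiset.mem_map.1 ha
    exact hs lam hlam
  rw [gradForm_apply, hline]
  rw [show ((eigenvalues f e x).map fun lam => Polynomial.X + Polynomial.C (s + lam)) =
      (((eigenvalues f e x).map fun lam => s + lam).map fun a => Polynomial.X + Polynomial.C a) by
    rw [Multiset.map_map]; rfl]
  rw [prod_X_add_C_eq_C_mul_prodOneAdd _ hne, ← mul_assoc, ← Polynomial.C_mul,
    Polynomial.coeff_C_mul, coeff_one_prodOneAdd, Multiset.map_map, mul_assoc]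
  rfl

/-- **Gradients at interior points cut out the cone.**  For a form `f` hyperbolic w.r.t. `e`
with `f(e) > 0`: if `x ∉ Λ₊(f, e)` there is an interior point `z ∈ Λ₊₊(f, e)` with
`⟨∇f(z), x⟩ < 0` — namely `z = x + s e` with `s = |λ_min(x)| (1 + 1/(2d))`, where
`⟨∇f(z), x⟩ = ⟨∇f(z), z⟩ - s⟨∇f(z), e⟩ = f(z) (d - Σᵢ s/(s + λᵢ(x))) ≤ f(z)(d - (2d + 1)) < 0`.
[cite: Renegar2006, §2] -/
theorem exists_gradForm_neg_of_not_mem (hf : f.IsHomogeneous d) (he : IsHyperbolic f e)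
    (hpos : 0 < MvPolynomial.eval e f) {x : σ → ℝ} (hx : x ∉ hyperbolicityCone f e) :
    ∃ z ∈ openHyperbolicityCone f e, gradForm f z x < 0 := by
  classical
  -- a negative eigenvalue, and the smallest eigenvalue `lam0 < 0`
  rw [mem_hyperbolicityCone_iff_eigenvalues_nonneg hf he] at hx
  push Not at hx
  obtain ⟨lam1, hlam1, hlam1neg⟩ := hx
  set ev := eigenvalues f e x with hev
  have hne : ev.toFinset.Nonempty := ⟨lam1, Multiset.mem_toFinset.2 hlam1⟩
  set lam0 := ev.toFinset.min' hne with hlam0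
  have hlam0mem : lam0 ∈ ev := Multiset.mem_toFinset.1 (Finset.min'_mem _ hne)
  have hlam0le : ∀ lam ∈ ev, lam0 ≤ lam := fun lam hlam =>
    Finset.min'_le _ _ (Multiset.mem_toFinset.2 hlam)
  have hlam0neg : lam0 < 0 := lt_of_le_of_lt (hlam0le lam1 hlam1) hlam1neg
  -- `d ≥ 1`
  have hcard : Multiset.card ev = d := card_eigenvalues hf he x
  have hdpos : (0 : ℝ) < d := by
    have : 0 < Multiset.card ev := Multiset.card_pos_iff_exists_mem.2 ⟨lam1, hlam1⟩
    rw [hcard] at this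
    exact_mod_cast this
  -- the shift `s = τ + δ`, `τ = -lam0`, `δ = τ / (2d)`
  set τ : ℝ := -lam0 with hτ
  have hτpos : 0 < τ := by rw [hτ]; linarith
  set δ : ℝ := τ / (2 * d) with hδ
  have hδpos : 0 < δ := div_pos hτpos (by positivity)
  set s : ℝ := τ + δ with hsdef
  have hspos : 0 < s := add_pos hτpos hδpos
  have hslam : ∀ lam ∈ ev, δ ≤ s + lam := fun lam hlam => by
    have := hlam0le lam hlam
    rw [hsdef, hτ]; linarith
  have hslam_pos : ∀ lam ∈ ev, 0 < s + lam := fun lam hlam => lt_of_lt_of_le hδpos (hslam lam hlam)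
  have hslam0 : s + lam0 = δ := by rw [hsdef, hτ]; ring
  -- the interior point `z = x + s e`
  set z := x + s • e with hz
  have hzmem : z ∈ openHyperbolicityCone f e := by
    intro t ht
    have hxt : z + t • e = x + (s + t) • e := by rw [hz, add_assoc, ← add_smul]
    rw [hxt, eval_add_smul_eq_eval_mul_prod_eigenvalues hf he x (s + t)]
    refine mul_ne_zero hpos.ne' (Multiset.prod_ne_zero fun h0 => ?_)
    obtain ⟨lam, hlam, hlam0'⟩ := Multiset.mem_map.1 h0
    have := hslam_pos lam hlam
    linarith
  have hfz : MvPolynomial.eval z f =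
      MvPolynomial.eval e f * (ev.map fun lam => s + lam).prod := by
    rw [hz, eval_add_smul_eq_eval_mul_prod_eigenvalues hf he x s]
  have hprodpos : 0 < (ev.map fun lam => s + lam).prod := by
    refine Multiset.prod_pos fun a ha => ?_
    obtain ⟨lam, hlam, rfl⟩ := Multiset.mem_map.1 ha
    exact hslam_pos lam hlam
  have hfzpos : 0 < MvPolynomial.eval z f := by rw [hfz]; exact mul_pos hpos hprodpos
  -- `⟨∇f(z), x⟩ = ⟨∇f(z), z⟩ - s ⟨∇f(z), e⟩ = f(z) (d - s Σ (s + λᵢ)⁻¹)`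
  have hsplit : gradForm f z x = gradForm f z z - s * gradForm f z e := by
    have hx' : x = z - s • e := by rw [hz]; abel
    conv_lhs => rw [hx']
    rw [map_sub, map_smul, smul_eq_mul]
  have hdir : gradForm f z e = MvPolynomial.eval z f * (ev.map fun lam => (s + lam)⁻¹).sum := by
    rw [hz, gradForm_dir_eq hf he x (fun lam hlam => (hslam_pos lam hlam).ne'), ← hz, hfz,
      mul_assoc]
  have hval : gradForm f z x =
      MvPolynomial.eval z f * ((d : ℝ) - s * (ev.map fun lam => (s + lam)⁻¹).sum) := by
    rw [hsplit, gradForm_self_eq hf z, hdir]; ring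
  -- the sum of inverses is at least the single term `(s + lam0)⁻¹ = δ⁻¹`
  have hsum_ge : (s + lam0)⁻¹ ≤ (ev.map fun lam => (s + lam)⁻¹).sum :=
    Multiset.single_le_sum (fun a ha => by
      obtain ⟨lam, hlam, rfl⟩ := Multiset.mem_map.1 ha
      exact (inv_pos.2 (hslam_pos lam hlam)).le) _
      (Multiset.mem_map_of_mem (fun lam => (s + lam)⁻¹) hlam0mem)
  refine ⟨z, hzmem, ?_⟩
  rw [hval]
  refine mul_neg_of_pos_of_neg hfzpos ?_
  have hkey : (d : ℝ) < s * (s + lam0)⁻¹ := by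
    rw [hslam0, hsdef, ← div_eq_mul_inv, add_div, div_self hδpos.ne', hδ, div_div_eq_mul_div,
      mul_comm τ (2 * d), mul_div_assoc, div_self hτpos.ne', mul_one]
    linarith
  have : s * (s + lam0)⁻¹ ≤ s * (ev.map fun lam => (s + lam)⁻¹).sum :=
    mul_le_mul_of_nonneg_left hsum_ge hspos.le
  linarith

/-- **The closed cone is cut out by its own gradient functionals**:
`Λ₊(f, e) = {x : ⟨∇f(z), x⟩ ≥ 0 for all z ∈ Λ₊(f, e)}` (Gårding's lemma for `⊆`,
`exists_gradForm_neg_of_not_mem` for `⊇`).  [cite: Garding1959, Thm 2] -/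
theorem hyperbolicityCone_eq_setOf_forall_gradForm_nonneg {n d : ℕ} {f : MvPolynomial (Fin n) ℝ}
    {e : Fin n → ℝ} (hf : f.IsHomogeneous d) (he : IsHyperbolic f e)
    (hpos : 0 < MvPolynomial.eval e f) :
    hyperbolicityCone f e = {x | ∀ z ∈ hyperbolicityCone f e, 0 ≤ gradForm f z x} := by
  ext x
  refine ⟨fun hx z hz => stub_gardingGradient n d f e hf he hpos z hz x hx, fun hx => ?_⟩
  by_contra hxK
  obtain ⟨z, hz, hneg⟩ := exists_gradForm_neg_of_not_mem hf he hpos hxK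
  exact absurd (hx z (openHyperbolicityCone_subset f e hz)) (not_le.2 hneg)

/-- Registered form (`stub_gradientCut`, infrastructure stub of the core `stub_permanentalGradientPsdRank`):
the new direction of `hyperbolicityCone_eq_setOf_forall_gradForm_nonneg` — a point pairing
nonnegatively with every gradient `∇f(z)`, `z ∈ Λ₊(f, e)`, lies in `Λ₊(f, e)`.
[cite: Garding1959, Thm 2] -/
theorem stub_gradientCut : ∀ (n d : ℕ) (f : MvPolynomial (Fin n) ℝ) (e : Fin n → ℝ), f.IsHomogeneous d → IsHyperbolic f e → 0 < MvPolynomial.eval e f → ∀ x : Fin n → ℝ, (∀ z ∈ hyperbolicityCone f e, 0 ≤ gradForm f z x) → x ∈ hyperbolicityCone f e :=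
  fun _ _ _ _ hf he hpos x hx =>
    (Set.ext_iff.1 (hyperbolicityCone_eq_setOf_forall_gradForm_nonneg hf he hpos) x).2 hx

end DualGeneration

end Summit.ValiantsHypothesis.ValiantsHypothesis.Theorems.PermanentalConesPermanentalConeHard

end
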